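import Mathlib
import Literature.Computability.MetaComplexity.PolynomialCalculus
import HarnessLib

/-!
# The knapsack (subset-sum) axiom needs linear polynomial-calculus degree (Impagliazzo–Pudlák–Sgall 1999)

Topic `Literature/Computability/MetaComplexity` (proof complexity; companion of
`PolynomialCalculus.lean`, whose `PC.DerivableInDegree` / `PC.RefutableInDegree` render PC/F with
the Boolean axioms `x_j² − x_j` built in, Krajíček 2019 §6.2).

NAMED FACT (D-0014, no proof): the degree lower bound `⌈n/2⌉ + 1` for PC refutations, over a field
of characteristic zero, of the single KNAPSACK axiom `α₁x₁ + ⋯ + α_nx_n − β` whose target `β` is not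
a subset sum of the coefficients.  Vendored for route `PneNP/PrimalityPlaces`: it grounds the crux
`Summit.PneNP.PneNP.Theses.PrimalityPlaces.CarryFreeKnapsackDegree` (stmt-PneNP-16925), whose
bilinear binary-value system `{Σ_{i,j≤m} 2^(i+j) x_i y_j − p, x_m − 1, y_m − 1}` becomes, after the
Boolean restriction `y := b` (any `b` with `b_m = 1`, value `B = Σ_j 2^j b_j ∈ [2^m, 2^(m+1))`) and
`x_m := 1`, the knapsack axiom `Σ_{i<m} (2^i B) x_i − (p − 2^m B)` with non-zero coefficients whose
subset sums are multiples of `B`, while `B ∤ p` for a prime `p > B > 1` — so the printed theorem is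
the natural hypothesis for that item (restriction does not raise PC degree:
`MLPC.totalDegree_restrictVar_le`, `PolynomialCalculusRestriction.lean`).  The grounder records the
reduction; provers judge it.

## Sources and what is printed

* R. Impagliazzo, P. Pudlák, J. Sgall, *Lower bounds for the polynomial calculus and the Gröbner
  basis algorithm*, Comput. Complexity **8** (1999) 127–144 [ImpagliazzoPudlakSgall1999] — the
  original (its subset-sum section; journal text not held on this hub: acquisition acq-02125, the
  theorem number inside [IPS99] is to be sharpened at reground).
* M. A. Forbes, A. Shpilka, I. Tzameret, A. Wigderson, *Proof complexity lower bounds from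
  algebraic circuit complexity*, CCC 2016 = arXiv:1606.05050 [ForbesShpilkaTzameretWigderson2016],
  **Theorem 90** of the arXiv version (Appendix, "Impagliazzo, Pudlák and Sgall [IPS99]"), read on
  the materialised text: "Let 𝔽 be a field of characteristic zero. Let α ∈ 𝔽ⁿ, β ∈ 𝔽 and
  A := {Σᵢ αᵢxᵢ : x ∈ {0,1}ⁿ} be so that β ∉ A. Then α₁x₁ + ⋯ + α_nx_n − β, x² − x is unsatisfiable
  and any PC refutation requires degree ≥ ⌈n/2⌉ + 1 and exp(Ω(n))-many monomials."; and p. 27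
  (§5.2): "[the IPS99 degree bound] actually holds for the (dynamic) polynomial calculus proof
  system … when f(x) = Σᵢ αᵢxᵢ − β for any α", with the matching PC upper bound ⌈n/2⌉ + 1.
* J. Krajíček, *Proof Complexity*, CUP 2019 [KrajicekProofComplexity2019], p. 343 (bibliographical
  remarks to Ch. 16): "the PC degree for all instances of the knapsack is linear; see Impagliazzo,
  Pudlák and Sgall [246]".

## Rendering (hypothesis by hypothesis)

* Field: `F` with `[Field F] [CharZero F]` ("characteristic zero", as in the FSTW restatement; the
  item of the route is over `ℚ`).
* Variables: exactly `x_1, …, x_n`, i.e. `MvPolynomial (Fin n) F` (as printed; a refutation using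
  further, idle variables is reduced to this case by `0/1`-restriction — not part of the fact).
* Axiom set: the single polynomial `Σᵢ C (α i) * X i − C β`; the Boolean axioms are supplied by
  `PC.DerivableInDegree.booleanAxiom` (the printed "`x² − x`").
* NON-ZERO COEFFICIENTS `∀ i, α i ≠ 0` — an explicit hypothesis HERE although the FSTW restatement
  says "α ∈ 𝔽ⁿ": with a zero coefficient the variable is idle and the bound `⌈n/2⌉ + 1` in the
  number `n` of variables fails trivially (e.g. `n = 4`, `α = (0,0,0,1)`, `β = 5`: the refutation
  `x₄·(x₄ − 5) − (x₄² − x₄) = −4x₄`, then `1`, has degree `2 < 3`), so the faithful reading of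
  "knapsack instance" has non-zero weights; adding the hypothesis can only weaken the fact.
* `β ∉ A`: `∀ S : Finset (Fin n), Σ_{i∈S} α i ≠ β`.
* Conclusion: every degree-`≤ d` refutation has `⌈n/2⌉ + 1 ≤ d`, with `⌈n/2⌉ = (n + 1) / 2` in `ℕ`.
* NOT vendored: the `exp(Ω(n))` monomial-count bound (unspecified constant), the matching upper
  bound, Nullstellensatz/IPS variants, and FSTW's own Theorem 4 (functional degree `n` for
  Nullstellensatz multipliers, `α = 1`).
-/

namespace Literature.Computability.MetaComplexity

open MvPolynomial
open scoped BigOperators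

namespace PC

/-- **Impagliazzo–Pudlák–Sgall knapsack degree lower bound** (named fact, D-0014).  Over a field
of characteristic zero, if `α₁, …, α_n` are non-zero and `β` is not of the form `Σ_{i∈S} αᵢ`, then
the polynomial system `{α₁x₁ + ⋯ + α_nx_n − β}` (with the Boolean axioms `xᵢ² − xᵢ` of PC built in)
is unsatisfiable on `{0,1}ⁿ` and every polynomial-calculus refutation of it has degree at least
`⌈n/2⌉ + 1`: in the tree's vocabulary, `PC.RefutableInDegree {Σᵢ C αᵢ · Xᵢ − C β} d → ⌈n/2⌉ + 1 ≤ d`.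
Printed: FSTW16 (arXiv:1606.05050) Thm. 90, restating [IPS99]: "Let 𝔽 be a field of
characteristic zero. Let α ∈ 𝔽ⁿ, β ∈ 𝔽 and A := {Σᵢ αᵢxᵢ : x ∈ {0,1}ⁿ} be so that β ∉ A. Then
α₁x₁ + ⋯ + α_nx_n − β, x² − x is unsatisfiable and any PC refutation requires degree ≥ ⌈n/2⌉ + 1
and exp(Ω(n))-many monomials"; Krajíček 2019 p. 343: "the PC degree for all instances of the
knapsack is linear [IPS99]".  The hypothesis `∀ i, α i ≠ 0` is made explicit here (see the module
docstring: with an idle variable the count `n` is wrong); the monomial bound is not vendored.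
Grounds `Summit.PneNP.PneNP.Theses.PrimalityPlaces.CarryFreeKnapsackDegree` (as a hypothesis, after
`0/1`-restriction of the `y`-block and of `x_m`).
[cite: ImpagliazzoPudlakSgall1999, subset-sum/knapsack theorem (as restated in FSTW16 Thm. 90)]
[cite: ForbesShpilkaTzameretWigderson2016, Thm. 90 (arXiv:1606.05050, Appendix) and §5.2 p. 27]
[cite: KrajicekProofComplexity2019, p. 343] -/
def ImpagliazzoPudlakSgall1999_knapsack_degree : Prop :=
  ∀ (F : Type) [Field F] [CharZero F] (n : ℕ) (α : Fin n → F) (β : F),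
    (∀ i, α i ≠ 0) →
    (∀ S : Finset (Fin n), ∑ i ∈ S, α i ≠ β) →
    ∀ d : ℕ,
      PC.RefutableInDegree
          ({(∑ i : Fin n, C (α i) * X i) - C β} : Set (MvPolynomial (Fin n) F)) d →
        (n + 1) / 2 + 1 ≤ d

end PC

end Literature.Computability.MetaComplexity
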